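import Mathlib.LinearAlgebra.Trace
import Mathlib.LinearAlgebra.Dual.Lemmas
import Mathlib.LinearAlgebra.FiniteDimensional.Lemmas
import Mathlib.Algebra.Algebra.Subalgebra.Basic
import HarnessLib

/-!
# Centre and derived algebra of a Lie algebra of operators with separating trace form: `𝔤 = 𝔷(𝔤) ⊕ [𝔤, 𝔤]` (Humphreys §5.1, §19.1 — the linear algebra of «reductive»)

Topic `Literature/Algebra/Lie`. Pure linear algebra over a field `K`, theorems only (no definition, no named fact,
D-0026). Written for the cell `pub-hodgecm2` (COR-CM), seat `b27` (count-neutral own lane MT-REDUCTIVE): it is the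
field-independent half of «the Lie algebra of the Hodge group of a polarizable Hodge structure is reductive»
(Deligne, LNM 900, I Prop. 3.6), consumed by `Literature/AlgebraicGeometry/Motives/HodgeThetaSubalgebraReductive`.

SETTING. `W` a finite-dimensional `K`-vector space, `𝔤 ⊆ End_K(W)` a `K`-subspace closed under the commutator
`XY - YX` (a Lie algebra of operators), on which the TRACE FORM `tr(XY)` of `W` is SEPARATING (`X ∈ 𝔤` and
`tr(XY) = 0` for all `Y ∈ 𝔤` force `X = 0`). Two explicit subspaces (spelled out in every statement, no notion is
introduced): the CENTRE `𝔷(𝔤) = 𝔤 ⊓ Subalgebra.toSubmodule (Subalgebra.centralizer K 𝔤)` and the DERIVED SPAN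
`𝔡(𝔤) = span_K {XY - YX : X, Y ∈ 𝔤}`.

RESULTS (J. E. Humphreys, *Introduction to Lie algebras and representation theory*, GTM 9: §5.1 «if `β` is a
nondegenerate invariant form, the orthogonal of an ideal is an ideal», §19.1 «`L` reductive … `L = Z(L) ⊕ [L, L]`»;
here for Lie algebras of operators and the trace form of the given representation):
* `TraceSeparating.central_iff_forall_trace_mul_derived_eq_zero` — `Z ∈ 𝔤` is central iff `tr(Z·𝔡(𝔤)) = 0`
  (the trace-orthogonal of `𝔡(𝔤)` in `𝔤` is the centre: `tr(Z[X,Y]) = tr([Z,X]Y)`);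
* **`TraceSeparating.finrank_center_add_finrank_derived`** — `dim 𝔷(𝔤) + dim 𝔡(𝔤) = dim 𝔤`;
* if moreover the trace form is ANISOTROPIC ON THE CENTRE (`Z` central, `tr(Z²) = 0 ⟹ Z = 0`; e.g. definite):
  **`TraceSeparating.center_inf_derived_eq_bot`**, **`TraceSeparating.center_sup_derived_eq`** (`𝔤 = 𝔷(𝔤) ⊕ 𝔡(𝔤)`),
  `TraceSeparating.exists_central_add_derived`, **`TraceSeparating.derived_eq_span_commutators_derived`**
  (`𝔡(𝔤)` is perfect), **`TraceSeparating.eq_zero_of_mem_derived_of_forall_commute`** (`𝔡(𝔤)` is centre-free),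
  **`TraceSeparating.eq_zero_of_mem_derived_of_forall_trace_mul_eq_zero`** (the trace form is separating on
  `𝔡(𝔤)`), `TraceSeparating.commutator_mem_derived` (`[𝔤, 𝔤] ⊆ 𝔡(𝔤)`, so `𝔡(𝔤)` is bracket-closed).

## References

* [Humphreys1972] J. E. Humphreys, *Introduction to Lie Algebras and Representation Theory*, GTM 9 (1972),
  §5.1 (invariant bilinear forms), §5.2, §19.1 (reductive Lie algebras).
* [Deligne1982HodgeCycles] P. Deligne, *Hodge cycles on abelian varieties*, LNM 900 (1982), I Prop. 3.6 (the
  consumer's source).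
-/

namespace Literature.Algebra.Lie

namespace TraceSeparating

variable {K : Type*} [Field K] {W : Type*} [AddCommGroup W] [Module K W] [FiniteDimensional K W]

omit [FiniteDimensional K W] in
/-- Membership in the centre `𝔷(𝔤) = 𝔤 ⊓ centralizer(𝔤)`: `Z ∈ 𝔤` and `Z Y = Y Z` for all `Y ∈ 𝔤`.
[cite: Humphreys1972, §1.2] -/
theorem mem_center_iff (𝔤 : Submodule K (Module.End K W)) (Z : Module.End K W) :
    Z ∈ 𝔤 ⊓ Subalgebra.toSubmodule (Subalgebra.centralizer K (𝔤 : Set (Module.End K W))) ↔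
      Z ∈ 𝔤 ∧ ∀ Y ∈ 𝔤, Z * Y = Y * Z := by
  rw [Submodule.mem_inf, Subalgebra.mem_toSubmodule, Subalgebra.mem_centralizer_iff]
  exact ⟨fun ⟨h1, h2⟩ => ⟨h1, fun Y hY => (h2 Y hY).symm⟩, fun ⟨h1, h2⟩ => ⟨h1, fun Y hY => (h2 Y hY).symm⟩⟩

omit [FiniteDimensional K W] in
/-- The derived span `𝔡(𝔤) = span {XY - YX}` lies in `𝔤` when `𝔤` is bracket-closed. [cite: Humphreys1972, §1.2] -/
theorem derived_le (𝔤 : Submodule K (Module.End K W)) (hbr : ∀ X ∈ 𝔤, ∀ Y ∈ 𝔤, X * Y - Y * X ∈ 𝔤) :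
    Submodule.span K {B | ∃ X ∈ 𝔤, ∃ Y ∈ 𝔤, X * Y - Y * X = B} ≤ 𝔤 := by
  rw [Submodule.span_le]
  rintro _ ⟨X, hX, Y, hY, rfl⟩
  exact hbr X hX Y hY

omit [FiniteDimensional K W] in
/-- `[𝔤, 𝔤] ⊆ 𝔡(𝔤)`: commutators of elements of `𝔤` lie in the derived span (by definition); in particular
`𝔡(𝔤)` is bracket-closed when `𝔤` is. [cite: Humphreys1972, §1.2] -/
theorem commutator_mem_derived (𝔤 : Submodule K (Module.End K W)) {X Y : Module.End K W} (hX : X ∈ 𝔤)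
    (hY : Y ∈ 𝔤) : X * Y - Y * X ∈ Submodule.span K {B | ∃ X ∈ 𝔤, ∃ Y ∈ 𝔤, X * Y - Y * X = B} :=
  Submodule.subset_span ⟨X, hX, Y, hY, rfl⟩

omit [FiniteDimensional K W] in
/-- **A central element is trace-orthogonal to the derived algebra**: `tr(Z B) = 0` for `Z` commuting with `𝔤`
and `B ∈ 𝔡(𝔤)` (`tr(Z(XY - YX)) = tr(XZY) - tr(ZYX) = 0`, cyclicity of the trace). [cite: Humphreys1972, §5.1] -/
theorem trace_mul_eq_zero_of_central_of_mem_derived (𝔤 : Submodule K (Module.End K W)) {Z : Module.End K W}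
    (hZc : ∀ Y ∈ 𝔤, Z * Y = Y * Z) {B : Module.End K W}
    (hB : B ∈ Submodule.span K {B | ∃ X ∈ 𝔤, ∃ Y ∈ 𝔤, X * Y - Y * X = B}) :
    LinearMap.trace K W (Z * B) = 0 := by
  induction hB using Submodule.span_induction with
  | mem B hB =>
    obtain ⟨X, hX, Y, hY, rfl⟩ := hB
    rw [mul_sub, map_sub, ← mul_assoc, hZc X hX, mul_assoc, LinearMap.trace_mul_comm K X (Z * Y), mul_assoc,
      sub_self]
  | zero => rw [mul_zero, map_zero]
  | add B B' _ _ hB hB' => rw [mul_add, map_add, hB, hB', add_zero]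
  | smul c B _ hB => rw [mul_smul_comm, map_smul, hB, smul_zero]

omit [FiniteDimensional K W] in
/-- **The trace-orthogonal of `𝔡(𝔤)` inside `𝔤` is the centre**: for a bracket-closed `𝔤` with separating trace
form, `Z ∈ 𝔤` is central iff `tr(Z B) = 0` for all `B ∈ 𝔡(𝔤)` (`⟸`: `tr((ZY - YZ)T) = tr(Z(YT - TY)) = 0` for all
`T ∈ 𝔤` forces `ZY - YZ = 0`). [cite: Humphreys1972, §5.1] -/
theorem central_iff_forall_trace_mul_derived_eq_zero (𝔤 : Submodule K (Module.End K W))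
    (hbr : ∀ X ∈ 𝔤, ∀ Y ∈ 𝔤, X * Y - Y * X ∈ 𝔤)
    (hsep : ∀ X ∈ 𝔤, (∀ Y ∈ 𝔤, LinearMap.trace K W (X * Y) = 0) → X = 0)
    {Z : Module.End K W} (hZ : Z ∈ 𝔤) :
    (∀ Y ∈ 𝔤, Z * Y = Y * Z) ↔
      ∀ B ∈ Submodule.span K {B | ∃ X ∈ 𝔤, ∃ Y ∈ 𝔤, X * Y - Y * X = B}, LinearMap.trace K W (Z * B) = 0 := by
  refine ⟨fun hZc B hB => trace_mul_eq_zero_of_central_of_mem_derived 𝔤 hZc hB, fun h Y hY => ?_⟩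
  have h0 := hsep _ (hbr Z hZ Y hY) fun T hT => by
    -- invariance of the trace form: `tr((ZY - YZ)T) = tr(Z(YT - TY))`
    have e : LinearMap.trace K W ((Z * Y - Y * Z) * T) = LinearMap.trace K W (Z * (Y * T - T * Y)) := by
      rw [sub_mul, mul_sub, map_sub, map_sub, mul_assoc, mul_assoc, LinearMap.trace_mul_comm K Y (Z * T),
        mul_assoc]
    rw [e]
    exact h _ (commutator_mem_derived 𝔤 hY hT)
  exact sub_eq_zero.1 h0

/-- **`dim 𝔷(𝔤) + dim 𝔡(𝔤) = dim 𝔤`** for a bracket-closed `𝔤 ⊆ End_K(W)` with separating trace form: the map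
`𝔤 → 𝔡(𝔤)^∨`, `X ↦ tr(X ·)`, is surjective (the trace form identifies `𝔤` with `𝔤^∨`, and restriction of
functionals to a subspace is onto) with kernel the centre (`central_iff_forall_trace_mul_derived_eq_zero`).
[cite: Humphreys1972, §5.1] [cite: Humphreys1972, §19.1] -/
theorem finrank_center_add_finrank_derived (𝔤 : Submodule K (Module.End K W))
    (hbr : ∀ X ∈ 𝔤, ∀ Y ∈ 𝔤, X * Y - Y * X ∈ 𝔤)
    (hsep : ∀ X ∈ 𝔤, (∀ Y ∈ 𝔤, LinearMap.trace K W (X * Y) = 0) → X = 0) :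
    Module.finrank K ↥(𝔤 ⊓ Subalgebra.toSubmodule (Subalgebra.centralizer K (𝔤 : Set (Module.End K W)))) +
      Module.finrank K ↥(Submodule.span K {B | ∃ X ∈ 𝔤, ∃ Y ∈ 𝔤, X * Y - Y * X = B}) =
        Module.finrank K 𝔤 := by
  classical
  have h𝔡le : Submodule.span K {B | ∃ X ∈ 𝔤, ∃ Y ∈ 𝔤, X * Y - Y * X = B} ≤ 𝔤 := derived_le 𝔤 hbr
  have h𝔷le : 𝔤 ⊓ Subalgebra.toSubmodule (Subalgebra.centralizer K (𝔤 : Set (Module.End K W))) ≤ 𝔤 :=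
    inf_le_left
  -- the centre seen inside `𝔤`
  rw [← (Submodule.comapSubtypeEquivOfLe h𝔷le).finrank_eq]
  -- the trace pairing `Ψ : 𝔤 → 𝔤^∨` and its composite `Φ` with restriction to `𝔡(𝔤)`
  let Ψ : 𝔤 →ₗ[K] Module.Dual K 𝔤 :=
    ((LinearMap.mul K (Module.End K W)).compr₂ (LinearMap.trace K W)).domRestrict₁₂ 𝔤 𝔤
  have hΨapply : ∀ x y : 𝔤, Ψ x y = LinearMap.trace K W ((x : Module.End K W) * (y : Module.End K W)) :=
    fun x y => rfl
  have hΨinj : Function.Injective Ψ := by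
    intro x x' h
    have hzero : ∀ Y ∈ 𝔤, LinearMap.trace K W (((x : Module.End K W) - x') * Y) = 0 := by
      intro Y hY
      have e := LinearMap.congr_fun h ⟨Y, hY⟩
      rw [hΨapply, hΨapply] at e
      rw [sub_mul, map_sub, e, sub_self]
    exact Subtype.ext (sub_eq_zero.1 (hsep _ (𝔤.sub_mem x.2 x'.2) hzero))
  have hΨsurj : Function.Surjective Ψ :=
    (LinearMap.injective_iff_surjective_of_finrank_eq_finrank (Subspace.dual_finrank_eq).symm).1 hΨinj
  set 𝔡 := Submodule.span K {B | ∃ X ∈ 𝔤, ∃ Y ∈ 𝔤, X * Y - Y * X = B} with h𝔡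
  let ι : 𝔡 →ₗ[K] 𝔤 := Submodule.inclusion h𝔡le
  let Φ : 𝔤 →ₗ[K] Module.Dual K 𝔡 := ι.dualMap ∘ₗ Ψ
  have hΦapply : ∀ (x : 𝔤) (d : 𝔡),
      Φ x d = LinearMap.trace K W ((x : Module.End K W) * (d : Module.End K W)) := fun x d => rfl
  have hΦsurj : Function.Surjective Φ := by
    intro φ
    obtain ⟨χ, hχ⟩ := LinearMap.dualMap_surjective_of_injective (Submodule.inclusion_injective h𝔡le) φ
    obtain ⟨x, hx⟩ := hΨsurj χ
    exact ⟨x, by rw [← hχ, ← hx]; rfl⟩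
  -- kernel of `Φ` = centre
  have hker : LinearMap.ker Φ =
      (𝔤 ⊓ Subalgebra.toSubmodule (Subalgebra.centralizer K (𝔤 : Set (Module.End K W)))).comap 𝔤.subtype := by
    ext x
    rw [LinearMap.mem_ker, Submodule.mem_comap, Submodule.subtype_apply, mem_center_iff]
    constructor
    · intro hx
      refine ⟨x.2, (central_iff_forall_trace_mul_derived_eq_zero 𝔤 hbr hsep x.2).2 fun B hB => ?_⟩
      have e := LinearMap.congr_fun hx ⟨B, hB⟩
      rw [hΦapply, LinearMap.zero_apply] at e
      exact e
    · rintro ⟨-, hxc⟩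
      ext d
      rw [hΦapply, LinearMap.zero_apply]
      exact trace_mul_eq_zero_of_central_of_mem_derived 𝔤 hxc d.2
  have hrange : Module.finrank K (LinearMap.range Φ) = Module.finrank K 𝔡 := by
    rw [LinearMap.range_eq_top.2 hΦsurj, finrank_top]
    exact Subspace.dual_finrank_eq
  have hrk := LinearMap.finrank_range_add_finrank_ker Φ
  rw [hrange, hker] at hrk
  rw [← hrk, add_comm]

omit [FiniteDimensional K W] in
/-- **`𝔷(𝔤) ∩ 𝔡(𝔤) = 0`** when, in addition, the trace form is anisotropic on the centre (`Z` central,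
`tr(Z²) = 0 ⟹ Z = 0`): a central `Z ∈ 𝔡(𝔤)` has `tr(Z·Z) = 0`. [cite: Humphreys1972, §19.1] -/
theorem center_inf_derived_eq_bot (𝔤 : Submodule K (Module.End K W))
    (haniso : ∀ Z ∈ 𝔤, (∀ Y ∈ 𝔤, Z * Y = Y * Z) → LinearMap.trace K W (Z * Z) = 0 → Z = 0) :
    𝔤 ⊓ Subalgebra.toSubmodule (Subalgebra.centralizer K (𝔤 : Set (Module.End K W))) ⊓
      Submodule.span K {B | ∃ X ∈ 𝔤, ∃ Y ∈ 𝔤, X * Y - Y * X = B} = ⊥ := by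
  rw [Submodule.eq_bot_iff]
  intro Z hZ
  rw [Submodule.mem_inf, mem_center_iff] at hZ
  obtain ⟨⟨hZ𝔤, hZc⟩, hZ𝔡⟩ := hZ
  exact haniso Z hZ𝔤 hZc (trace_mul_eq_zero_of_central_of_mem_derived 𝔤 hZc hZ𝔡)

/-- **`𝔤 = 𝔷(𝔤) + 𝔡(𝔤)`** (hence `𝔤 = 𝔷(𝔤) ⊕ 𝔡(𝔤)` with `center_inf_derived_eq_bot`): both pieces lie in `𝔤`, they
meet in `0`, and their dimensions add up to `dim 𝔤`. This is «`𝔤` reductive ⟹ `𝔤 = Z(𝔤) ⊕ [𝔤, 𝔤]`» for Lie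
algebras of operators with separating trace form anisotropic on the centre. [cite: Humphreys1972, §19.1] -/
theorem center_sup_derived_eq (𝔤 : Submodule K (Module.End K W))
    (hbr : ∀ X ∈ 𝔤, ∀ Y ∈ 𝔤, X * Y - Y * X ∈ 𝔤)
    (hsep : ∀ X ∈ 𝔤, (∀ Y ∈ 𝔤, LinearMap.trace K W (X * Y) = 0) → X = 0)
    (haniso : ∀ Z ∈ 𝔤, (∀ Y ∈ 𝔤, Z * Y = Y * Z) → LinearMap.trace K W (Z * Z) = 0 → Z = 0) :
    𝔤 ⊓ Subalgebra.toSubmodule (Subalgebra.centralizer K (𝔤 : Set (Module.End K W))) ⊔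
      Submodule.span K {B | ∃ X ∈ 𝔤, ∃ Y ∈ 𝔤, X * Y - Y * X = B} = 𝔤 := by
  set 𝔷 := 𝔤 ⊓ Subalgebra.toSubmodule (Subalgebra.centralizer K (𝔤 : Set (Module.End K W))) with h𝔷
  set 𝔡 := Submodule.span K {B | ∃ X ∈ 𝔤, ∃ Y ∈ 𝔤, X * Y - Y * X = B} with h𝔡
  have hle : 𝔷 ⊔ 𝔡 ≤ 𝔤 := sup_le inf_le_left (derived_le 𝔤 hbr)
  refine Submodule.eq_of_le_of_finrank_eq hle ?_
  have h1 := Submodule.finrank_sup_add_finrank_inf_eq 𝔷 𝔡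
  have h2 : 𝔷 ⊓ 𝔡 = ⊥ := center_inf_derived_eq_bot 𝔤 haniso
  rw [h2, finrank_bot, add_zero, finrank_center_add_finrank_derived 𝔤 hbr hsep] at h1
  exact h1

/-- **Decomposition of elements**: every `X ∈ 𝔤` is `Z + D` with `Z` central in `𝔤` and `D ∈ 𝔡(𝔤)`.
[cite: Humphreys1972, §19.1] -/
theorem exists_central_add_derived (𝔤 : Submodule K (Module.End K W))
    (hbr : ∀ X ∈ 𝔤, ∀ Y ∈ 𝔤, X * Y - Y * X ∈ 𝔤)
    (hsep : ∀ X ∈ 𝔤, (∀ Y ∈ 𝔤, LinearMap.trace K W (X * Y) = 0) → X = 0)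
    (haniso : ∀ Z ∈ 𝔤, (∀ Y ∈ 𝔤, Z * Y = Y * Z) → LinearMap.trace K W (Z * Z) = 0 → Z = 0)
    {X : Module.End K W} (hX : X ∈ 𝔤) :
    ∃ Z ∈ 𝔤, (∀ Y ∈ 𝔤, Z * Y = Y * Z) ∧
      ∃ D ∈ Submodule.span K {B | ∃ X ∈ 𝔤, ∃ Y ∈ 𝔤, X * Y - Y * X = B}, X = Z + D := by
  have h := center_sup_derived_eq 𝔤 hbr hsep haniso
  have hX' : X ∈ 𝔤 ⊓ Subalgebra.toSubmodule (Subalgebra.centralizer K (𝔤 : Set (Module.End K W))) ⊔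
      Submodule.span K {B | ∃ X ∈ 𝔤, ∃ Y ∈ 𝔤, X * Y - Y * X = B} := by rw [h]; exact hX
  obtain ⟨Z, hZ, D, hD, rfl⟩ := Submodule.mem_sup.1 hX'
  rw [mem_center_iff] at hZ
  exact ⟨Z, hZ.1, hZ.2, D, hD, rfl⟩

/-- **`𝔡(𝔤)` is perfect: `𝔡(𝔤) = [𝔡(𝔤), 𝔡(𝔤)]`** (the span of the commutators of its own elements): writing
`X = Z + D`, `X' = Z' + D'` with `Z, Z'` central, `XX' - X'X = DD' - D'D`. [cite: Humphreys1972, §19.1]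
[cite: Humphreys1972, §5.2] -/
theorem derived_eq_span_commutators_derived (𝔤 : Submodule K (Module.End K W))
    (hbr : ∀ X ∈ 𝔤, ∀ Y ∈ 𝔤, X * Y - Y * X ∈ 𝔤)
    (hsep : ∀ X ∈ 𝔤, (∀ Y ∈ 𝔤, LinearMap.trace K W (X * Y) = 0) → X = 0)
    (haniso : ∀ Z ∈ 𝔤, (∀ Y ∈ 𝔤, Z * Y = Y * Z) → LinearMap.trace K W (Z * Z) = 0 → Z = 0) :
    Submodule.span K {B | ∃ X ∈ 𝔤, ∃ Y ∈ 𝔤, X * Y - Y * X = B} =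
      Submodule.span K {B | ∃ X ∈ Submodule.span K {B | ∃ X ∈ 𝔤, ∃ Y ∈ 𝔤, X * Y - Y * X = B},
        ∃ Y ∈ Submodule.span K {B | ∃ X ∈ 𝔤, ∃ Y ∈ 𝔤, X * Y - Y * X = B}, X * Y - Y * X = B} := by
  set 𝔡 := Submodule.span K {B | ∃ X ∈ 𝔤, ∃ Y ∈ 𝔤, X * Y - Y * X = B} with h𝔡
  have h𝔡le : 𝔡 ≤ 𝔤 := derived_le 𝔤 hbr
  refine le_antisymm ?_ ?_
  · rw [h𝔡, Submodule.span_le]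
    rintro _ ⟨X, hX, X', hX', rfl⟩
    obtain ⟨Z, -, hZc, D, hD, rfl⟩ := exists_central_add_derived 𝔤 hbr hsep haniso hX
    obtain ⟨Z', hZ'𝔤, hZ'c, D', hD', rfl⟩ := exists_central_add_derived 𝔤 hbr hsep haniso hX'
    have hD𝔤 : D ∈ 𝔤 := h𝔡le hD
    have hD'𝔤 : D' ∈ 𝔤 := h𝔡le hD'
    have e : (Z + D) * (Z' + D') - (Z' + D') * (Z + D) = D * D' - D' * D := by
      have h1 : Z * Z' = Z' * Z := hZc Z' hZ'𝔤
      have h2 : Z * D' = D' * Z := hZc D' hD'𝔤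
      have h3 : D * Z' = Z' * D := (hZ'c D hD𝔤).symm
      rw [add_mul, mul_add, mul_add, add_mul, mul_add, mul_add, h1, h2, h3]
      abel
    rw [SetLike.mem_coe, e]
    exact Submodule.subset_span ⟨D, hD, D', hD', rfl⟩
  · rw [Submodule.span_le]
    rintro _ ⟨X, hX, Y, hY, rfl⟩
    exact commutator_mem_derived 𝔤 (h𝔡le hX) (h𝔡le hY)

/-- **`𝔡(𝔤)` has trivial centre**: an element of `𝔡(𝔤)` commuting with `𝔡(𝔤)` commutes with `𝔤 = 𝔷(𝔤) + 𝔡(𝔤)`,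
hence is central in `𝔤`, hence lies in `𝔷(𝔤) ∩ 𝔡(𝔤) = 0`. [cite: Humphreys1972, §19.1] -/
theorem eq_zero_of_mem_derived_of_forall_commute (𝔤 : Submodule K (Module.End K W))
    (hbr : ∀ X ∈ 𝔤, ∀ Y ∈ 𝔤, X * Y - Y * X ∈ 𝔤)
    (hsep : ∀ X ∈ 𝔤, (∀ Y ∈ 𝔤, LinearMap.trace K W (X * Y) = 0) → X = 0)
    (haniso : ∀ Z ∈ 𝔤, (∀ Y ∈ 𝔤, Z * Y = Y * Z) → LinearMap.trace K W (Z * Z) = 0 → Z = 0)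
    {C : Module.End K W} (hC : C ∈ Submodule.span K {B | ∃ X ∈ 𝔤, ∃ Y ∈ 𝔤, X * Y - Y * X = B})
    (hCc : ∀ D ∈ Submodule.span K {B | ∃ X ∈ 𝔤, ∃ Y ∈ 𝔤, X * Y - Y * X = B}, C * D = D * C) : C = 0 := by
  have hC𝔤 : C ∈ 𝔤 := derived_le 𝔤 hbr hC
  have hCcent : ∀ Y ∈ 𝔤, C * Y = Y * C := by
    intro Y hY
    obtain ⟨Z, -, hZc, D, hD, rfl⟩ := exists_central_add_derived 𝔤 hbr hsep haniso hY
    rw [mul_add, add_mul, ← hZc C hC𝔤, hCc D hD]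
  have hmem : C ∈ 𝔤 ⊓ Subalgebra.toSubmodule (Subalgebra.centralizer K (𝔤 : Set (Module.End K W))) ⊓
      Submodule.span K {B | ∃ X ∈ 𝔤, ∃ Y ∈ 𝔤, X * Y - Y * X = B} :=
    Submodule.mem_inf.2 ⟨(mem_center_iff 𝔤 C).2 ⟨hC𝔤, hCcent⟩, hC⟩
  rw [center_inf_derived_eq_bot 𝔤 haniso] at hmem
  exact (Submodule.mem_bot K).1 hmem

/-- **The trace form is separating on `𝔡(𝔤)`**: if `D ∈ 𝔡(𝔤)` is trace-orthogonal to `𝔡(𝔤)`, it is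
trace-orthogonal to `𝔤 = 𝔷(𝔤) + 𝔡(𝔤)` (central elements are orthogonal to `𝔡(𝔤)`), hence `D = 0`.
[cite: Humphreys1972, §5.1] [cite: Humphreys1972, §19.1] -/
theorem eq_zero_of_mem_derived_of_forall_trace_mul_eq_zero (𝔤 : Submodule K (Module.End K W))
    (hbr : ∀ X ∈ 𝔤, ∀ Y ∈ 𝔤, X * Y - Y * X ∈ 𝔤)
    (hsep : ∀ X ∈ 𝔤, (∀ Y ∈ 𝔤, LinearMap.trace K W (X * Y) = 0) → X = 0)
    (haniso : ∀ Z ∈ 𝔤, (∀ Y ∈ 𝔤, Z * Y = Y * Z) → LinearMap.trace K W (Z * Z) = 0 → Z = 0)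
    {D : Module.End K W} (hD : D ∈ Submodule.span K {B | ∃ X ∈ 𝔤, ∃ Y ∈ 𝔤, X * Y - Y * X = B})
    (htr : ∀ D' ∈ Submodule.span K {B | ∃ X ∈ 𝔤, ∃ Y ∈ 𝔤, X * Y - Y * X = B},
      LinearMap.trace K W (D * D') = 0) : D = 0 := by
  refine hsep D (derived_le 𝔤 hbr hD) fun Y hY => ?_
  obtain ⟨Z, -, hZc, D', hD', rfl⟩ := exists_central_add_derived 𝔤 hbr hsep haniso hY
  rw [mul_add, map_add, htr D' hD', add_zero, LinearMap.trace_mul_comm]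
  exact trace_mul_eq_zero_of_central_of_mem_derived 𝔤 hZc hD

end TraceSeparating

end Literature.Algebra.Lie
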